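import Summits.QuantumFields.BalabanUV.Beta.GAN24.W3SourceRowsEnd
import Summits.QuantumFields.BalabanUV.Beta.MixedJetTablesPlug

/-!
# `BalabanUV.Beta.GAN24.W3SourceRowsEndRoot` — binder row G-an2-4 / (CONV-C), W-slot road «W3»: ROWS W3-F4a / W3-F4b IN END-CURRENCY (`mom := 0`, every input
# rate `δin ≤ δ*`, GENERIC mixed table) AT THE ROOTED BORDER `vh₂SAt (toSite r) Lc`, `d = 3`, `Lc ≥ 2` — referee r53 (w9) ROOT ALIGNMENT, row (B) of the row
# owner's `SLOT-COVERAGE.md` (the β-lead's literal `MixedJetTablesPlug.JsBalAn1` / `JsBalAn1Ctr`, road BF-x's family)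

NOT IN PRINT; OUR PROOF ATTEMPT (row owner b2b-balaban-gan24-p1, gen 6).  [folklore] packaging: `W3SourceRowsEnd.hb_three` / `hf_three` VERBATIM with the base border
`vh₂S 3 Lc` replaced by `vh₂SAt (toSite r) Lc` — leaf-08's generic-border rows `W3SourceRowsBorder.hb_border` / `hf_border` fed with an1's `MixedJetTablesPlug.hB_an1 hLc hr`,
the K-slot (`KSlotAssembly.convCKWall_holds`) and the S-slot shapes (`SpureUnitDrift.e3ShapeDrift_three`) BY NAME.  (leaf-08's `W3SourceRowsRoot.hb_an1_three` /
`hf_an1_three` are the same rows with the mixed table ALSO instantiated at `mixFFAt (toSite r) Lc`; the generic-mixed-table form here is what the composition modules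
`T2ShapeThreeOfF2a` / `W3ForcingOfZS` consume.)  HONEST FRAMING (cell contract, verbatim): «discharging `BetaPertH` makes Bałaban's UV stability UNCONDITIONAL — a real
constructive-QFT result; it is NOT the continuum limit and NOT the Clay problem.»  HONEST DEPENDENCY (verbatim): «continuum YM on T⁴ ⇐ BetaPertH ∧ nine spine estimates
(0/9 proved); BetaPertH ⇐ (D1) ∧ (D4) ∧ CAP+tail; G-an2-4 gates asym, D1 and NE2/3/4.»  Discharges NOTHING of (hW, hWall) by itself; asserts nothing about «T2Shape»
(`hx` stays a binder of F4b); 0 `def`, 0 cite, 0 `def … : Prop`, 0 sorry; NOT «W-slot closed», NEVER «G-an2-4 closed», NOT (CONV-C) for `G_k/H_k`; NOT BetaPertH, NOT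
continuum, NOT Clay.
-/

noncomputable section

open Literature.MathematicalPhysics.QuantumFieldTheory
open Literature.MathematicalPhysics.QuantumFieldTheory.Balaban1983to89
open Literature.MathematicalPhysics.QuantumFieldTheory.Balaban1983to89.Beta
open AffineAveraging (box toSite)
open ExpKernelCalculus (MKer)
open OneStepResolventKernel (Fib LocStencil)
open OneStepKernelFamily (KInvStep)
open StepJetData (mfNeg)
open BalabanStepJetsSucc (mmRead wE e3Of)
open BalabanCompositeJets (LocStencil₂)
open SecondOrderResponse (W2SymOfK LocStencilFM)
open BalabanStepW2 (Spure M1 M2Of K3OfK)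
open AveragingMixedJetTables (vh₂SAt)
open Summit.QuantumFields.BalabanUV.Beta.HessKerDressedUnits (unitK unitS)
open Summit.QuantumFields.BalabanUV.Beta.SecondOrderUnits (unitM unitM₂)
open Summit.QuantumFields.BalabanUV.Beta.MixedJetTablesPlug (hB_an1)
open Summit.QuantumFields.BalabanUV.Beta.GAN24.CombesThomas (sfStep smStep UnitDecayK CauchyDecayK)
open Summit.QuantumFields.BalabanUV.Beta.GAN24.StencilSlotOfE3 (one_le_of_two_le)
open Summit.QuantumFields.BalabanUV.Beta.GAN24.SpureUnitDrift (e3ShapeDrift_three)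
open Summit.QuantumFields.BalabanUV.Beta.GAN24.KSlotAssembly (convCKWall_holds)
open Summit.QuantumFields.BalabanUV.Beta.GAN24.T2RecursionAffine (lin4)
open Summit.QuantumFields.BalabanUV.Beta.GAN24.W3SourceRowsBorder (hb_border hf_border)

namespace Summit.QuantumFields.BalabanUV.Beta.GAN24.W3SourceRowsEndRoot

section Three

variable {Lc : ℕ} [NeZero Lc] {r : Fin (3 + 1) → ℕ}

/-- **ROW W3-F4a AT THE ROOTED BORDER `vh₂SAt (toSite r) Lc` (`r ∈ box (3+1) Lc`), `d = 3`, `Lc ≥ 2`, `mom := 0`, EVERY INPUT RATE `δin ≤ δ*` — FROM THE MIXED-TABLE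
SHAPE ALONE** [folklore packaging]: K-slot by `KSlotAssembly.convCKWall_holds`, «E3Shape» by `SpureUnitDrift.e3ShapeDrift_three`, into `W3SourceRowsBorder.hb_border` with `hB := MixedJetTablesPlug.hB_an1 hLc hr`. -/
theorem hb_three_at (hLc : 2 ≤ Lc) (hr : r ∈ box (3 + 1) Lc) (cE cVH cΛ cE₂ cB : ℝ)
    {mixFF : Fin (3 + 1) → (Fin (3 + 1) → ℤ) → Fin (3 + 1) → (Fin (3 + 1) → ℤ) → MKer (3 + 1) (Fib 3)} {CM₂ δ₄ : ℝ}
    (hmix : LocStencilFM Lc mixFF CM₂ δ₄) (hδ₄ : 0 < δ₄)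
    (hfm : ∀ κ u ρ w x z (α μ' : Fin (3 + 1)), mixFF κ u ρ w x z (Sum.inl α) (Sum.inr μ') = 0)
    (hm : ∀ κ u ρ w x z (μ' : Fin (3 + 1)) (b : Fib 3), mixFF κ u ρ w x z (Sum.inr μ') b = 0) :
    ∃ Cb δb : ℝ, 0 ≤ Cb ∧ 0 < δb ∧ ∀ ⦃δin : ℝ⦄, δin ≤ δb → ∀ m, LocStencil₂ (fun κ u κ' u' =>
      (cE₂ * (Lc : ℝ) ^ (2 * (3 + 1))) •
          mmRead Lc (K3OfK (unitK (sfStep Lc m) (smStep 3 Lc m) (KInvStep (d := 3) Lc m)) Lc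
            (unitS (sfStep Lc m) (smStep 3 Lc m) (Spure 3 Lc cE cVH cΛ m)) (unitM (sfStep Lc m) (smStep 3 Lc m) (M1 3 Lc cΛ m))
            (W2SymOfK (unitK (sfStep Lc m) (smStep 3 Lc m) (KInvStep (d := 3) Lc m)) Lc
              (unitS (sfStep Lc m) (smStep 3 Lc m) (Spure 3 Lc cE cVH cΛ m)) (unitM (sfStep Lc m) (smStep 3 Lc m) (M1 3 Lc cΛ m)) 0
              (unitM₂ (sfStep Lc m) (smStep 3 Lc m) (M2Of 3 Lc mixFF m))) κ u κ' u')
        + cB • mfNeg ((vh₂SAt (toSite r) Lc) κ u κ' u')) Cb δin ∧ 0 ≤ Cb := by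
  obtain ⟨C, δ, cK, θ, hδ, -, -, hK, -⟩ := convCKWall_holds (Lc := Lc) hLc
  obtain ⟨C₃, c₃, θ₃, δ₃, -, -, hδ₃, hE3, -⟩ := e3ShapeDrift_three (Lc := Lc) hLc cE cVH cΛ
  exact hb_border (one_le_of_two_le hLc) hK hδ hE3 hδ₃ hmix hδ₄ hfm hm (hB_an1 (one_le_of_two_le hLc) hr) cE₂ cB

/-- **ROW W3-F4b AT THE ROOTED BORDER `vh₂SAt (toSite r) Lc` (`r ∈ box (3+1) Lc`), `d = 3`, `Lc ≥ 2`, `mom := 0`, EVERY INPUT RATE `δin ≤ δ*`, AS A FUNCTION OF THE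
TOWER's UNIFORM SHAPE — FROM THE MIXED-TABLE SHAPE AND `hx` ALONE** [folklore packaging]: K-slot (both rows) by `KSlotAssembly.convCKWall_holds`,
«E3Shape» ∧ «E3Drift» by `SpureUnitDrift.e3ShapeDrift_three`, into `W3SourceRowsBorder.hf_border` with `hB := MixedJetTablesPlug.hB_an1 hLc hr`; CONDITIONAL on `hx` (= «T2Shape», END #1's output; ref2 R53-3 ∕
R57-3: END #3 chooses the difference tower's `δin′ ≤ δ*` AFTER END #1's output). -/
theorem hf_three_at (hLc : 2 ≤ Lc) (cE cVH cΛ cE₂ cB : ℝ)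
    {mixFF : Fin (3 + 1) → (Fin (3 + 1) → ℤ) → Fin (3 + 1) → (Fin (3 + 1) → ℤ) → MKer (3 + 1) (Fib 3)} {CM₂ δ₄ : ℝ}
    (hmix : LocStencilFM Lc mixFF CM₂ δ₄) (hδ₄ : 0 < δ₄)
    (hfm : ∀ κ u ρ w x z (α μ' : Fin (3 + 1)), mixFF κ u ρ w x z (Sum.inl α) (Sum.inr μ') = 0)
    (hm : ∀ κ u ρ w x z (μ' : Fin (3 + 1)) (b : Fib 3), mixFF κ u ρ w x z (Sum.inr μ') b = 0)
    {x : ℕ → Fin (3 + 1) → (Fin (3 + 1) → ℤ) → Fin (3 + 1) → (Fin (3 + 1) → ℤ) → MKer (3 + 1) (Fib 3)} {C₂ δ₂ : ℝ}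
    (hx : ∀ j, LocStencil₂ (x j) C₂ δ₂) (hδ₂ : 0 < δ₂) :
    ∃ Cf θ δf : ℝ, 0 ≤ Cf ∧ 0 ≤ θ ∧ θ < 1 ∧ 0 < δf ∧ ∀ ⦃δin : ℝ⦄, δin ≤ δf → ∀ m, LocStencil₂
      ((lin4 (cE₂ * (Lc : ℝ) ^ (2 * (3 + 1))) (unitK (sfStep Lc (m + 1)) (smStep 3 Lc (m + 1)) (KInvStep (d := 3) Lc (m + 1))) Lc (x m)
          - lin4 (cE₂ * (Lc : ℝ) ^ (2 * (3 + 1))) (unitK (sfStep Lc m) (smStep 3 Lc m) (KInvStep (d := 3) Lc m)) Lc (x m))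
        + ((fun κ u κ' u' => (cE₂ * (Lc : ℝ) ^ (2 * (3 + 1))) •
            mmRead Lc (K3OfK (unitK (sfStep Lc (m + 1)) (smStep 3 Lc (m + 1)) (KInvStep (d := 3) Lc (m + 1))) Lc
              (unitS (sfStep Lc (m + 1)) (smStep 3 Lc (m + 1)) (Spure 3 Lc cE cVH cΛ (m + 1)))
              (unitM (sfStep Lc (m + 1)) (smStep 3 Lc (m + 1)) (M1 3 Lc cΛ (m + 1)))
              (W2SymOfK (unitK (sfStep Lc (m + 1)) (smStep 3 Lc (m + 1)) (KInvStep (d := 3) Lc (m + 1))) Lc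
                (unitS (sfStep Lc (m + 1)) (smStep 3 Lc (m + 1)) (Spure 3 Lc cE cVH cΛ (m + 1)))
                (unitM (sfStep Lc (m + 1)) (smStep 3 Lc (m + 1)) (M1 3 Lc cΛ (m + 1))) 0
                (unitM₂ (sfStep Lc (m + 1)) (smStep 3 Lc (m + 1)) (M2Of 3 Lc mixFF (m + 1)))) κ u κ' u')
            + cB • mfNeg ((vh₂SAt (toSite r) Lc) κ u κ' u'))
          - (fun κ u κ' u' => (cE₂ * (Lc : ℝ) ^ (2 * (3 + 1))) •
            mmRead Lc (K3OfK (unitK (sfStep Lc m) (smStep 3 Lc m) (KInvStep (d := 3) Lc m)) Lc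
              (unitS (sfStep Lc m) (smStep 3 Lc m) (Spure 3 Lc cE cVH cΛ m)) (unitM (sfStep Lc m) (smStep 3 Lc m) (M1 3 Lc cΛ m))
              (W2SymOfK (unitK (sfStep Lc m) (smStep 3 Lc m) (KInvStep (d := 3) Lc m)) Lc
                (unitS (sfStep Lc m) (smStep 3 Lc m) (Spure 3 Lc cE cVH cΛ m)) (unitM (sfStep Lc m) (smStep 3 Lc m) (M1 3 Lc cΛ m)) 0
                (unitM₂ (sfStep Lc m) (smStep 3 Lc m) (M2Of 3 Lc mixFF m))) κ u κ' u')
            + cB • mfNeg ((vh₂SAt (toSite r) Lc) κ u κ' u'))))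
      (Cf * θ ^ m) δin ∧ 0 ≤ Cf * θ ^ m := by
  obtain ⟨C, δ, cK, θ, hδ, hθ0, hθ1, hK, hKall⟩ := convCKWall_holds (Lc := Lc) hLc
  obtain ⟨C₃, c₃, θ₃, δ₃, hθ₃, hθ₃1, hδ₃, hE3, hE3d⟩ := e3ShapeDrift_three (Lc := Lc) hLc cE cVH cΛ
  exact hf_border (one_le_of_two_le hLc) hK hKall hδ hθ0 hθ1 hE3 hE3d hθ₃ hθ₃1 hδ₃ hmix hδ₄ hfm hm _ cE₂ cB hx hδ₂

end Three

end Summit.QuantumFields.BalabanUV.Beta.GAN24.W3SourceRowsEndRoot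

end
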